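import Mathlib
import Summits.NavierStokesRegularity.NavierStokesRegularity.Theorems.L3TimeExponentPincerJawFullMorrey
import Summits.NavierStokesRegularity.NavierStokesRegularity.Theorems.L3TimeExponentPincerJawMorreyRate
import Summits.NavierStokesRegularity.NavierStokesRegularity.Theorems.NoBlowupToClay
import Summits.NavierStokesRegularity.NavierStokesRegularity.Theses.TypeICertificateLadder
import HarnessLib.Audit
import HarnessLib

/-!
# `L3TimeExponentPincer` — the MORREY PINCER: placement of the residual crux `SupercriticalSerrinL3`
# against scaled-energy-Type-I exclusion, and the route re-cut on the Morrey axis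

Helper file (cell seat nsreg-p2, ROUND-9 Addendum B; `--supports stmt-NavierStokesRegularity-19499 --as helper`).
Bears on the parent crux `L3CascadeJaw` (19499) and the declared residual `SupercriticalSerrinL3` (19500).

The landed placement `…L3TimeExponentPincerSerrinBridges.noTypeIBlowup_of_supercriticalSerrinL3` says the
residual contains TIME-Type-I exclusion (`NoTypeIBlowup`, hard core 1217).  Theorem J′
(`…L3TimeExponentPincerJawFullMorrey`) sharpens this: modulo the literature fact `MazyaTraceD`
(Maz'ya 1985 §1.4.2 Thm 2) the residual contains the exclusion of every SCALED-ENERGY-Type-I blow-up: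

* `NoFullMorreyTypeIBlowup` — no frame blow-up is full-Morrey-Type-I near its time (`FullMorreyTypeINear`:
  `∫_{B(x₀,r)}|u(t)|² ≤ M r` on all late slices, all centres, all small radii; Type-II sup-rates allowed).
  This is the conclusion that Liouville-type hard cores (bounded ancient solutions) are built to deliver; it is
  STRONGER than `NoTypeIBlowup` (`noTypeIBlowup_of_noFullMorrey`, via `fullMorreyTypeINear_of_typeI`).
* `noFullMorreyBlowup_of_supercriticalSerrinL3` — `MazyaTraceD → SupercriticalSerrinL3 → NoFullMorreyTypeIBlowup`.
* `navierStokesRegularity_of_morreyPincer` — the route re-cut on the Morrey axis: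
  `AllBlowupsFullMorreyB` (every frame blow-up is full-Morrey-Type-I; WEAKER than `NoTypeII`, J′ file) and
  `NoFullMorreyTypeIBlowup` (STRONGER than `NoTypeIBlowup`) give Fefferman's (A) through the shared support
  `navierStokesRegularity_of_noBlowup`.  Compared with the certificate ladder's pair (`NoTypeII`, `NoTypeIBlowup`)
  the Morrey pincer moves weight from the Type-II jaw to the Type-I jaw.
* `hasSmoothExtensionPast_of_morreyRate_L5` — theorem J″ read through the residual: modulo `MazyaTraceD` and
  `SupercriticalSerrinL3`, a frame solution whose worst-ball scaled energy `Φ(t)` lies in `L⁵(T₁,T)` extends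
  smoothly past `T` (a Serrin-type criterion on the Morrey LEVEL, conditional on the residual).

WHAT THIS IS NOT: no item is closed; implications between typed open statements and one literature fact.
No hard core is assumed. 0 sorry.
-/

noncomputable section

namespace Summit.NavierStokesRegularity.NavierStokesRegularity.Theorems.L3TimeExponentPincerSerrinMorreyBridge

open MeasureTheory Set Function Filter Metric Topology
open scoped ENNReal NNReal
open Literature.Analysis.FluidPDE
open Summit.NavierStokesRegularity.NavierStokesRegularity.Theses.L3TimeExponentPincer (SupercriticalSerrinL3)
open Summit.NavierStokesRegularity.NavierStokesRegularity.Theses.TypeICertificateLadder (NoTypeIBlowup)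
open Summit.NavierStokesRegularity.NavierStokesRegularity.Theorems.L3TimeExponentPincerJawFullMorrey
open Summit.NavierStokesRegularity.NavierStokesRegularity.Theorems.L3TimeExponentPincerJawMorreyRate
open Literature.Analysis.FunctionSpaces (MazyaTraceD)

/-- **Scaled-energy-Type-I exclusion**: no frame solution that is full-Morrey-Type-I near `T` fails to extend
past `T`. -/
def NoFullMorreyTypeIBlowup : Prop :=
  ∀ (ν T : ℝ), 0 < ν → 0 < T →
    ∀ (u : ℝ → (EuclideanSpace ℝ (Fin 3)) → (EuclideanSpace ℝ (Fin 3))) (p : ℝ → (EuclideanSpace ℝ (Fin 3)) → ℝ),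
      IsClassicalNSSolutionOn (Ico 0 T) ν 0 u p → IsLerayHopfOn T ν 0 (u 0) u → HasRapidSpatialDecay (u 0) →
      FullMorreyTypeINear u T → HasSmoothExtensionPast ν 0 u T

/-- The Morrey-axis node is STRONGER than the hard core `NoTypeIBlowup` (stmt-1217): a time-Type-I blow-up is
full-Morrey-Type-I (`fullMorreyTypeINear_of_typeI`, through `scaledEnergyBound_proof`). -/
theorem noTypeIBlowup_of_noFullMorrey (h : NoFullMorreyTypeIBlowup) : NoTypeIBlowup :=
  fun ν T hν hT u p hcl hLH hdec hTI =>
    h ν T hν hT u p hcl hLH hdec (fullMorreyTypeINear_of_typeI hν hT hcl hLH hdec hTI)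

/-- **Residual placement, sharpened by J′**: modulo Maz'ya's trace inequality, the residual crux
`SupercriticalSerrinL3` excludes every scaled-energy-Type-I blow-up (the jaw `∫_{T₂}^T ‖u‖₃^q < ∞` holds on the
full-Morrey class for all `q ≤ 6`, in particular at the residual's exponent `q < 5`). -/
theorem noFullMorreyBlowup_of_supercriticalSerrinL3 (hMZ : MazyaTraceD) (h : SupercriticalSerrinL3) :
    NoFullMorreyTypeIBlowup := by
  obtain ⟨q, hq4, hq5, hS⟩ := h
  intro ν T hν hT u p hcl hLH hdec hFM
  exact hS ν T hν hT u p hcl hLH hdec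
    (jawUpToSix_of_mazya hMZ ν T hν hT u p hcl hLH hFM q (by linarith) (by linarith))

/-- **The Morrey pincer**: (every frame blow-up is full-Morrey-Type-I) ∧ (no full-Morrey-Type-I blow-up) ⟹ (A). -/
theorem navierStokesRegularity_of_morreyPincer (hA : AllBlowupsFullMorreyB) (hN : NoFullMorreyTypeIBlowup) :
    NavierStokesRegularity :=
  Summit.NavierStokesRegularity.NavierStokesRegularity.Theorems.navierStokesRegularity_of_noBlowup
    fun ν T hν hT u p hcl hLH hdec => by
      by_contra hne
      exact hne (hN ν T hν hT u p hcl hLH hdec (hA ν T hν hT u p hcl hLH hdec hne))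

/-- The Morrey pincer with the residual crux as the Type-I jaw (modulo `MazyaTraceD`). -/
theorem navierStokesRegularity_of_allBlowupsFullMorrey_of_supercriticalSerrinL3 (hMZ : MazyaTraceD)
    (hA : AllBlowupsFullMorreyB) (h : SupercriticalSerrinL3) : NavierStokesRegularity :=
  navierStokesRegularity_of_morreyPincer hA (noFullMorreyBlowup_of_supercriticalSerrinL3 hMZ h)

/-- `x^a ≤ x^5 + 1` in `ℝ≥0∞` for `0 ≤ a ≤ 5`. -/
theorem rpow_le_rpow_five_add_one (x : ℝ≥0∞) {a : ℝ} (ha0 : 0 ≤ a) (ha5 : a ≤ 5) :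
    x ^ a ≤ x ^ (5 : ℝ) + 1 := by
  by_cases h1 : 1 ≤ x
  · exact (ENNReal.rpow_le_rpow_of_exponent_le h1 ha5).trans le_self_add
  · exact (ENNReal.rpow_le_one (le_of_not_ge h1) ha0).trans le_add_self

/-- **J″ through the residual — a Serrin-type criterion on the Morrey LEVEL** (conditional on
`SupercriticalSerrinL3`, modulo `MazyaTraceD`): if the worst-ball scaled energy admits a measurable majorant
`Φ` with `∫_{T₁}^{T} Φ⁵ < ∞`, the frame solution extends smoothly past `T`. -/
theorem hasSmoothExtensionPast_of_morreyRate_L5 (hMZ : MazyaTraceD) (h : SupercriticalSerrinL3)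
    {ν T : ℝ} (hν : 0 < ν) (hT : 0 < T)
    {u : ℝ → (EuclideanSpace ℝ (Fin 3)) → (EuclideanSpace ℝ (Fin 3))} {p : ℝ → (EuclideanSpace ℝ (Fin 3)) → ℝ}
    (hcl : IsClassicalNSSolutionOn (Ico 0 T) ν 0 u p) (hLH : IsLerayHopfOn T ν 0 (u 0) u)
    (hdec : HasRapidSpatialDecay (u 0)) {Φ : ℝ → ℝ≥0} (hΦm : Measurable Φ) (hΦ : MorreyRateNear u T Φ)
    (hint : ∃ T₁ < T, ∫⁻ t in Ioo T₁ T, (Φ t : ℝ≥0∞) ^ (5 : ℝ) < ⊤) :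
    HasSmoothExtensionPast ν 0 u T := by
  obtain ⟨q, hq4, hq5, hS⟩ := h
  obtain ⟨T₁, hT₁, hint⟩ := hint
  have h6q : 0 < 6 - q := by linarith
  have ha0 : 0 ≤ q / (6 - q) := (div_pos (by linarith) h6q).le
  have ha5 : q / (6 - q) ≤ 5 := by rw [div_le_iff₀ h6q]; linarith
  refine hS ν T hν hT u p hcl hLH hdec
    (jaw_of_morreyRate_mazya hMZ hν hT hcl hLH hΦm hΦ (by linarith) (by linarith) ⟨T₁, hT₁, ?_⟩)
  calc ∫⁻ t in Ioo T₁ T, (Φ t : ℝ≥0∞) ^ (q / (6 - q))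
      ≤ ∫⁻ t in Ioo T₁ T, ((Φ t : ℝ≥0∞) ^ (5 : ℝ) + 1) :=
        lintegral_mono fun t => rpow_le_rpow_five_add_one _ ha0 ha5
    _ = (∫⁻ t in Ioo T₁ T, (Φ t : ℝ≥0∞) ^ (5 : ℝ)) + ∫⁻ t in Ioo T₁ T, (1 : ℝ≥0∞) :=
        lintegral_add_right' _ aemeasurable_const
    _ < ⊤ := by
        refine ENNReal.add_lt_top.2 ⟨hint, ?_⟩
        rw [setLIntegral_const, Real.volume_Ioo]
        exact ENNReal.mul_lt_top ENNReal.one_lt_top ENNReal.ofReal_lt_top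

end Summit.NavierStokesRegularity.NavierStokesRegularity.Theorems.L3TimeExponentPincerSerrinMorreyBridge
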